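import Summits.QuantumFields.BalabanUV.Beta.FP.PerfectTelescopingBottom
import Summits.QuantumFields.BalabanUV.Beta.FP.PerfectGaugeDefectBottom
import Summits.QuantumFields.BalabanUV.Beta.FP.TwoLevelDefectClosedForm

/-!
# `BalabanUV.Beta.FP.PerfectGaugeDefectBottomLimit` — road «FP» for binder row D1, W-ORACLE-K row **SPLIT, part (i-b)** (owner d1-p3 gen 15, memo
# `HOME/b2b-balaban-beta-d1-p3/N2B-DESIGN.md` v3.1 §11 (11b); journal [D1P3-G15-WORACLEK]): **THE PERFECT BOTTOM TWO-LEVEL DEFECT `E♭_m` IS THE ENTRYWISE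
# `j → ∞` LIMIT OF THE FINITE-`j` BOTTOM DEFECTS, UNCONDITIONALLY (`d + 1 = 4`, `Lc ≥ 2`, `m ≥ 1`), AND EVERY FINITE-WINDOW BILINEAR COMBINATION OF ITS FIELD–FIELD
# ENTRIES VANISHES AS SOON AS IT VANISHES AT (EVENTUALLY) EVERY FINITE `j`** — the owner's «then `j → ∞` entrywise (`tendsto_KTot_KPerf_holds`; Π has a finite window
# so `Π·K_j·Πᵀ → Π·K·Πᵀ` entrywise is a finite sum of limits)» as a Π-agnostic theorem

HONEST DEPENDENCY (page 1, mandatory): continuum YM on T⁴ ⇐ BetaPertH ∧ nine spine estimates (0/9 proved); BetaPertH ⇐ (D1) ∧ (D4) ∧ CAP+tail;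
G-an2-4 gates asym, D1 and NE2/3/4.  HONEST FRAMING (cell contract, verbatim): «discharging `BetaPertH` makes Bałaban's UV stability UNCONDITIONAL —
a real constructive-QFT result; it is NOT the continuum limit and NOT the Clay problem.»  THIS MODULE is [folklore] unit bookkeeping + ONE Tannery passage to the
limit (the tree's generic `PerfectTelescopingLimit.tendsto_comp_liftW_comp`) + finite sums of limits, over this lineage's g42 layer (`PerfectTelescopingBottom`,
`PerfectTelescopingBottomFinite`, `PerfectTelescopingFiniteUnits`) and the road's UNCONDITIONAL K-side rows `GAN24.RealRateKMHolds.tendsto_KTot_KPerf_holds` ∕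
`GAN24.KSlotJMHolds.kSlotJM_holds` BY NAME.  No `def`, no `def … : Prop`, nothing cited, nothing of Bałaban's asserted, 0 sorry; 0 estimates of Bałaban's constrained
objects.  0∕4 row-D1 binders; NOT the finite-`j` Π-kill (SPLIT (i-a), leaf-06: `TwoLevelDefectClosedForm` + `NestedDressingProjector.symAxProjNestAt_grad_eq_zero_of_blockSum`
+ the Form↔kernel bridge), NOT SPLIT (ii)(iii), NOT `G_N = G₁ + G_c`, NOT (SDF), NOT D1, NOT `BetaPertH`, NOT continuum, NOT Clay.  «not in print; our bookkeeping».

ABSOLUTE RULE (cell charter, verbatim): «No internally-minted statement may enter as a cited fact. Every hypothesis is either kernel-proved in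
this package or a verbatim quotation of a PUBLISHED theorem with page reference. The manuscript(s) under audit are NOT citable for their own
disputed steps — they are the thing under adjudication; programme-internal (2001/route/tribunal) claims are never citable.»

WHY (§11 (11b) (i)).  Row SPLIT wants ONE kernel identity `G_N = G₁ + G_c` for the Π-dressed perfect `(m+1)`-fold resolvent; its ff content is that the perfect BOTTOM
two-level defect `E♭_m := [KPerf (m+1) − (KPerf 1 − (Lc·Lc)⁻¹·KPerf 1 ∘ liftW Lc true true (KPerf m) ∘ KPerf 1)]_ff` (the owner's `PerfectGaugeDefectBottom` bracket; its
transverse pairings vanish by this lineage's `kPerf_pair_telescoping_bottom_holds`) is killed entrywise by the finite-window nested projector: `Π·E♭_m·Πᵀ = 0`.  The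
owner's route has two halves: (i-a) AT FINITE `j` the closed form `Σ'_y (C_y ⊗ dzθ_y + dzθ_y ⊗ C_y)` is killed by `Π` (leaf-06's files); (i-b) `j → ∞` ENTRYWISE under
the finite window.  THIS FILE is (i-b), with `Π` entering only as two arbitrary FINITE families of real coefficients (a row of `trK Π`, a column of `Π`), so that
(i-a) may be proved in the BARE `KTot` currency of `PerfectTelescopingBottomFinite.kTot_pair_telescoping_bottom_step` — where `k1aBottom` ∕ `dec_compB_apply` ∕
an5's two-level decomposition read the finite-`j` bottom defect — and conclude at the perfect objects by `exact`.

CONTENT (`U_i := unitK (Lc^i) (Lc^{i(d+1)})`, the road's adopted units `sfStep` ∕ `smStep`).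
* §1 [folklore] **`rescaledDefectBottom_ff_eq`** (every `d`, `Lc ≥ 1`): the ff entry of the unit-rescaled finite-`j` bottom defect
  `U_j KTot_{(j,1+m)} − (U_j KTot_{(j,1)} − (Lc·Lc)⁻¹·[U_j KTot_{(j,1)} ∘ liftW Lc true true (U_{j+1} KTot_{(j+1,m)}) ∘ U_j KTot_{(j,1)}])`
  EQUALS `(Lc^j)²·` the BARE bracket `KTot_{(j,1+m)} − (KTot_{(j,1)} − ((Lc^j)^{d+2})²·[KTot_{(j,1)} ∘ liftW Lc true true (KTot_{(j+1,m)}) ∘ KTot_{(j,1)}])` (same entry).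
* §2 [folklore] **`tendsto_perfectDefectBottom_apply`** (every `d`, `Lc ≥ 1`; convergence ∕ decay rows DISPLAYED exactly as in `PerfectTelescopingBottom.kPerf_pair_telescoping_bottom`)
  and [our proof] **`tendsto_perfectDefectBottom_apply_holds`** (`d + 1 = 4`, `Lc ≥ 2`, `m ≥ 1`, ALL rows supplied): for every `x y κ l` the rescaled finite-`j` bottom
  defect entry tends to `E♭_m(x,y;κ,l)`.
* §3 [folklore] **`window_eq_zero_of_eventually`** (generic: a finite bilinear window of an entrywise-convergent family that vanishes eventually vanishes at the limit),
  **`perfectDefectBottom_window_eq_zero_holds`**: for all finsets `S S′` of sites and coefficient families `p q : (Fin 4 → ℤ) → Fin 4 → ℝ`,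
  `(∀ᶠ j, Σ_{x∈S} Σ_κ Σ_{y∈S′} Σ_l p x κ · E_j^{bare}(x,y;κ,l) · q y l = 0) → Σ_{x∈S} Σ_κ Σ_{y∈S′} Σ_l p x κ · E♭_m(x,y;κ,l) · q y l = 0`.
* §4 [folklore] the JUNCTION for (i-a): **`bareDefectBottom_ff_eq_sum_twoLevelDefect`** — `E_j^{bare}(x′,y′;κ,l) = Σ_{i,i′ ∈ LegIdx (Lc^j)} ((Lc^j)^{d+2})⁻² ·
  [Γ_{N′} − Γ_M − PQ_{N′,M}](κ, p_i; l, q_{i′})` at `(M, N′) = (Lc^(j+1), Lc^(j+1+m))`, `p_i ∕ q_{i′}` the fine leg points of the `Lc^j`-blocks `x′ ∕ y′` (`KTot_def`,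
  `dec_inl_inl`, `KInv_inl_inl`, this lineage's `dec_compB_eq_comp_KTot` ∕ `compB_eq_neg_PQ`) — i.e. the LHS of `TwoLevelDefectClosedForm.twoLevelDefect_closedForm`;
  **`bareDefectBottom_ff_eq_sum_closedForm`** — the same with the closed form substituted (`N′ = M·Lc^m`): every term carries `blockSum_M (Mcol_{N′} …) y₀`
  (`= −dz θ_{y₀}`) on exactly one fine leg point — the object the finite-window projector is to kill.
Unit `b2b-balaban-gan24-formalise-leaf-05` (gen 45; author of MS-1-BOT (ii) `PerfectTelescopingBottom` g42), road «FP» row SPLIT (i-b) (journal «MINE» 2026-08-21 l.34557).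
-/

noncomputable section

namespace Summit.QuantumFields.BalabanUV.Beta.FP.PerfectGaugeDefectBottomLimit

open Finset Filter Topology
open scoped BigOperators
open Literature.MathematicalPhysics.QuantumFieldTheory.Balaban1983to89
open Literature.MathematicalPhysics.QuantumFieldTheory.Balaban1983to89.Beta
open ExpKernelCalculus (MKer Decays comp)
open OneStepResolventKernel (Fib)
open InterLevelTransport (liftW)
open HessKerDressedLimit (limMKerOf)
open Summit.QuantumFields.BalabanUV.Beta.HessKerDressedUnits (unitK unitK_apply legScale legScale_inl)
open Summit.QuantumFields.BalabanUV.Beta.GAN24.CombesThomas (sfStep smStep)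
open Summit.QuantumFields.BalabanUV.Beta.GAN24.RealRateKMHolds (tendsto_KTot_KPerf_holds)
open Summit.QuantumFields.BalabanUV.Beta.GAN24.KSlotJMHolds (kSlotJM_holds)
open Summit.QuantumFields.BalabanUV.Beta.FP.PerfectObjects (KTot)
open Summit.QuantumFields.BalabanUV.Beta.FP.PerfectObjectsT (KPerf)
open Summit.QuantumFields.BalabanUV.Beta.FP.StationarityK (limMKerOf_add)
open Summit.QuantumFields.BalabanUV.Beta.FP.PerfectTelescopingFiniteUnits (comp_unitK_liftW_unitK_ff unitScalar_adopted)
open Summit.QuantumFields.BalabanUV.Beta.FP.PerfectTelescopingLimit (tendsto_limMKerOf_apply tendsto_comp_liftW_comp)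
open Summit.QuantumFields.BalabanUV.Beta.FP.PerfectTelescopingHolds (decays_le_const)
open AffineAveraging (dz codiff₁ blockSum)
open KKTFluctuationKernel (Gam)
open KKTFluctuationEnergy (Gcol Mcol)
open OneStepResolventKernel (KInv KInv_inl_inl)
open OneStepKernelFamily (dec legPt LegIdx)
open ResolventCompositionStepB (PQ dec_inl_inl)
open Summit.QuantumFields.BalabanUV.Beta.FP.PerfectTelescopingBottomFinite (compB_eq_neg_PQ dec_compB_eq_comp_KTot)
open Summit.QuantumFields.BalabanUV.Beta.FP.TwoLevelDefectClosedForm (twoLevelDefect_closedForm)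

variable {d : ℕ} (Lc : ℕ) [NeZero Lc]

/-! ## §1 Units: the rescaled finite-`j` bottom defect entry is `(Lc^j)²` times the bare one -/

/-- [folklore] **THE RESCALED FINITE-`j` BOTTOM DEFECT, FIELD–FIELD ENTRY, IN THE BARE `KTot` CURRENCY** (`Lc ≥ 1`, adopted units `U_i := unitK (Lc^i) (Lc^{i(d+1)})`):
the ff entry of `U_j KTot_{(j,1+m)} − (U_j KTot_{(j,1)} − (Lc·Lc)⁻¹·[U_j KTot_{(j,1)} ∘ liftW Lc true true (U_{j+1} KTot_{(j+1,m)}) ∘ U_j KTot_{(j,1)}])` is `(Lc^j)²` times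
the bracket of `PerfectTelescopingBottomFinite.kTot_pair_telescoping_bottom_step` (scalar `((Lc^j)^{d+2})²`) at the same entry. -/
theorem rescaledDefectBottom_ff_eq (hLc : 1 ≤ Lc) (j m : ℕ) (x y : Fin (d + 1) → ℤ) (κ l : Fin (d + 1)) :
    unitK ((Lc : ℝ) ^ j) ((Lc : ℝ) ^ (j * (d + 1))) (KTot (d := d) (Lc ^ (j + 1 + m)) (Lc ^ j)) x y (Sum.inl κ) (Sum.inl l)
        - (unitK ((Lc : ℝ) ^ j) ((Lc : ℝ) ^ (j * (d + 1))) (KTot (d := d) (Lc ^ (j + 1)) (Lc ^ j)) x y (Sum.inl κ) (Sum.inl l)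
          - (((Lc : ℝ)) * ((Lc : ℝ)))⁻¹
            * comp (unitK ((Lc : ℝ) ^ j) ((Lc : ℝ) ^ (j * (d + 1))) (KTot (d := d) (Lc ^ (j + 1)) (Lc ^ j)))
                (comp (liftW Lc true true
                    (unitK ((Lc : ℝ) ^ (j + 1)) ((Lc : ℝ) ^ ((j + 1) * (d + 1))) (KTot (d := d) (Lc ^ (j + 1 + m)) (Lc ^ (j + 1)))))
                  (unitK ((Lc : ℝ) ^ j) ((Lc : ℝ) ^ (j * (d + 1))) (KTot (d := d) (Lc ^ (j + 1)) (Lc ^ j))))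
                x y (Sum.inl κ) (Sum.inl l))
      = (Lc : ℝ) ^ j * (Lc : ℝ) ^ j
        * (KTot (d := d) (Lc ^ (j + 1 + m)) (Lc ^ j) x y (Sum.inl κ) (Sum.inl l)
          - (KTot (d := d) (Lc ^ (j + 1)) (Lc ^ j) x y (Sum.inl κ) (Sum.inl l)
            - ((((Lc ^ j : ℕ) : ℝ)) ^ (d + 2) * (((Lc ^ j : ℕ) : ℝ)) ^ (d + 2))
              * comp (KTot (d := d) (Lc ^ (j + 1)) (Lc ^ j))
                  (comp (liftW Lc true true (KTot (d := d) (Lc ^ (j + 1 + m)) (Lc ^ (j + 1)))) (KTot (d := d) (Lc ^ (j + 1)) (Lc ^ j)))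
                  x y (Sum.inl κ) (Sum.inl l))) := by
  have hL : (Lc : ℝ) ≠ 0 := by exact_mod_cast (show Lc ≠ 0 by omega)
  rw [comp_unitK_liftW_unitK_ff, unitK_apply, unitK_apply, legScale_inl, legScale_inl]
  -- the adopted scalar: `(Lc·Lc)⁻¹ · (Lc^j·Lc^{j(d+1)})² · (Lc^{j+1})² = (Lc^j)² · ((Lc^j)^{d+2})²`
  have hsc := unitScalar_adopted (d := d) Lc hLc j 1
  rw [pow_one] at hsc
  have hD : ((((Lc : ℝ)) ^ (j * (d + 1)) * (Lc : ℝ) ^ (j + 1)) * (((Lc : ℝ)) ^ (j * (d + 1)) * (Lc : ℝ) ^ (j + 1))) ≠ 0 := by positivity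
  have hsc' : (((Lc : ℝ)) * ((Lc : ℝ)))⁻¹
        * ((((Lc : ℝ)) ^ (j * (d + 1)) * (Lc : ℝ) ^ (j + 1)) * (((Lc : ℝ)) ^ (j * (d + 1)) * (Lc : ℝ) ^ (j + 1)))
      = (((Lc ^ j : ℕ) : ℝ)) ^ (d + 2) * (((Lc ^ j : ℕ) : ℝ)) ^ (d + 2) := by
    rw [← hsc, div_mul_cancel₀ _ hD]
  have key : (((Lc : ℝ)) * ((Lc : ℝ)))⁻¹
        * ((Lc : ℝ) ^ j * (Lc : ℝ) ^ (j * (d + 1)) * ((Lc : ℝ) ^ j * (Lc : ℝ) ^ (j * (d + 1)))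
          * ((Lc : ℝ) ^ (j + 1) * (Lc : ℝ) ^ (j + 1)))
      = (Lc : ℝ) ^ j * (Lc : ℝ) ^ j * ((((Lc ^ j : ℕ) : ℝ)) ^ (d + 2) * (((Lc ^ j : ℕ) : ℝ)) ^ (d + 2)) := by
    rw [← hsc']
    ring
  rw [show (((Lc : ℝ)) * ((Lc : ℝ)))⁻¹
        * ((Lc : ℝ) ^ j * (Lc : ℝ) ^ (j * (d + 1)) * ((Lc : ℝ) ^ j * (Lc : ℝ) ^ (j * (d + 1)))
          * ((Lc : ℝ) ^ (j + 1) * (Lc : ℝ) ^ (j + 1))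
          * comp (KTot (d := d) (Lc ^ (j + 1)) (Lc ^ j))
              (comp (liftW Lc true true (KTot (d := d) (Lc ^ (j + 1 + m)) (Lc ^ (j + 1)))) (KTot (d := d) (Lc ^ (j + 1)) (Lc ^ j)))
              x y (Sum.inl κ) (Sum.inl l))
      = (Lc : ℝ) ^ j * (Lc : ℝ) ^ j * ((((Lc ^ j : ℕ) : ℝ)) ^ (d + 2) * (((Lc ^ j : ℕ) : ℝ)) ^ (d + 2))
          * comp (KTot (d := d) (Lc ^ (j + 1)) (Lc ^ j))
              (comp (liftW Lc true true (KTot (d := d) (Lc ^ (j + 1 + m)) (Lc ^ (j + 1)))) (KTot (d := d) (Lc ^ (j + 1)) (Lc ^ j)))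
              x y (Sum.inl κ) (Sum.inl l) by rw [← mul_assoc, key]]
  ring

/-! ## §2 The entrywise limit `j → ∞` -/

/-- [folklore] **THE PERFECT BOTTOM DEFECT IS THE ENTRYWISE LIMIT OF THE RESCALED FINITE-`j` BOTTOM DEFECTS, from displayed rows** (every `d`, `Lc ≥ 1`;
`U_j := unitK (Lc^j) (Lc^{j(d+1)})`).  ASSUME (displayed, asserted nowhere): every entry of the rescaled (j, m+1)-, (j, 1)- and (j, m)-families converges as
`j → ∞`; the rescaled (j, 1)-family decays `j`-uniformly; the rescaled (j, m)-family is `j`-uniformly bounded.  THEN for every `x y κ l`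
`[U_j KTot_{(j,1+m)} − (U_j KTot_{(j,1)} − (Lc·Lc)⁻¹·U_j KTot_{(j,1)} ∘ liftW Lc true true (U_{j+1} KTot_{(j+1,m)}) ∘ U_j KTot_{(j,1)})](x,y;inl κ,inl l)`
`⟶ [KPerf (m+1) − (KPerf 1 − (Lc·Lc)⁻¹·KPerf 1 ∘ liftW Lc true true (KPerf m) ∘ KPerf 1)](x,y;inl κ,inl l)`. -/
theorem tendsto_perfectDefectBottom_apply (m : ℕ) {CB δB CS : ℝ} (hδB : 0 < δB)
    (hconvA : ∀ x y a b, ∃ L, Tendsto (fun j => unitK ((Lc : ℝ) ^ j) ((Lc : ℝ) ^ (j * (d + 1)))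
      (KTot (d := d) (Lc ^ (j + (m + 1))) (Lc ^ j)) x y a b) atTop (𝓝 L))
    (hconvB : ∀ x y a b, ∃ L, Tendsto (fun j => unitK ((Lc : ℝ) ^ j) ((Lc : ℝ) ^ (j * (d + 1)))
      (KTot (d := d) (Lc ^ (j + 1)) (Lc ^ j)) x y a b) atTop (𝓝 L))
    (hconvC : ∀ x y a b, ∃ L, Tendsto (fun j => unitK ((Lc : ℝ) ^ j) ((Lc : ℝ) ^ (j * (d + 1)))
      (KTot (d := d) (Lc ^ (j + m)) (Lc ^ j)) x y a b) atTop (𝓝 L))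
    (hBd : ∀ j, Decays (unitK ((Lc : ℝ) ^ j) ((Lc : ℝ) ^ (j * (d + 1))) (KTot (d := d) (Lc ^ (j + 1)) (Lc ^ j))) CB δB)
    (hCb : ∀ j z w (a b : Fib d), |unitK ((Lc : ℝ) ^ j) ((Lc : ℝ) ^ (j * (d + 1))) (KTot (d := d) (Lc ^ (j + m)) (Lc ^ j)) z w a b| ≤ CS)
    (x y : Fin (d + 1) → ℤ) (κ l : Fin (d + 1)) :
    Tendsto (fun j =>
        unitK ((Lc : ℝ) ^ j) ((Lc : ℝ) ^ (j * (d + 1))) (KTot (d := d) (Lc ^ (j + 1 + m)) (Lc ^ j)) x y (Sum.inl κ) (Sum.inl l)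
          - (unitK ((Lc : ℝ) ^ j) ((Lc : ℝ) ^ (j * (d + 1))) (KTot (d := d) (Lc ^ (j + 1)) (Lc ^ j)) x y (Sum.inl κ) (Sum.inl l)
            - (((Lc : ℝ)) * ((Lc : ℝ)))⁻¹
              * comp (unitK ((Lc : ℝ) ^ j) ((Lc : ℝ) ^ (j * (d + 1))) (KTot (d := d) (Lc ^ (j + 1)) (Lc ^ j)))
                  (comp (liftW Lc true true
                      (unitK ((Lc : ℝ) ^ (j + 1)) ((Lc : ℝ) ^ ((j + 1) * (d + 1))) (KTot (d := d) (Lc ^ (j + 1 + m)) (Lc ^ (j + 1)))))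
                    (unitK ((Lc : ℝ) ^ j) ((Lc : ℝ) ^ (j * (d + 1))) (KTot (d := d) (Lc ^ (j + 1)) (Lc ^ j))))
                  x y (Sum.inl κ) (Sum.inl l)))
      atTop
      (𝓝 (KPerf (d := d) Lc (fun j => (Lc : ℝ) ^ j) (fun j => (Lc : ℝ) ^ (j * (d + 1))) (m + 1) x y (Sum.inl κ) (Sum.inl l)
          - (KPerf (d := d) Lc (fun j => (Lc : ℝ) ^ j) (fun j => (Lc : ℝ) ^ (j * (d + 1))) 1 x y (Sum.inl κ) (Sum.inl l)
            - (((Lc : ℝ)) * ((Lc : ℝ)))⁻¹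
              * comp (KPerf (d := d) Lc (fun j => (Lc : ℝ) ^ j) (fun j => (Lc : ℝ) ^ (j * (d + 1))) 1)
                  (comp (liftW Lc true true (KPerf (d := d) Lc (fun j => (Lc : ℝ) ^ j) (fun j => (Lc : ℝ) ^ (j * (d + 1))) m))
                    (KPerf (d := d) Lc (fun j => (Lc : ℝ) ^ j) (fun j => (Lc : ℝ) ^ (j * (d + 1))) 1))
                  x y (Sum.inl κ) (Sum.inl l)))) := by
  -- the three rescaled families and their constructed limits (as in `PerfectTelescopingBottom.kPerf_pair_telescoping_bottom`)
  set A : ℕ → MKer (d + 1) (Fib d) := fun j => unitK ((Lc : ℝ) ^ j) ((Lc : ℝ) ^ (j * (d + 1)))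
    (KTot (d := d) (Lc ^ (j + (m + 1))) (Lc ^ j)) with hA
  set B : ℕ → MKer (d + 1) (Fib d) := fun j => unitK ((Lc : ℝ) ^ j) ((Lc : ℝ) ^ (j * (d + 1)))
    (KTot (d := d) (Lc ^ (j + 1)) (Lc ^ j)) with hB
  set C : ℕ → MKer (d + 1) (Fib d) := fun j => unitK ((Lc : ℝ) ^ j) ((Lc : ℝ) ^ (j * (d + 1)))
    (KTot (d := d) (Lc ^ (j + m)) (Lc ^ j)) with hC
  have hKA : KPerf (d := d) Lc (fun j => (Lc : ℝ) ^ j) (fun j => (Lc : ℝ) ^ (j * (d + 1))) (m + 1) = limMKerOf A := rfl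
  have hKB : KPerf (d := d) Lc (fun j => (Lc : ℝ) ^ j) (fun j => (Lc : ℝ) ^ (j * (d + 1))) 1 = limMKerOf B := rfl
  have hKC : KPerf (d := d) Lc (fun j => (Lc : ℝ) ^ j) (fun j => (Lc : ℝ) ^ (j * (d + 1))) m = limMKerOf C := rfl
  have hKC' : limMKerOf (fun j => C (j + 1)) = limMKerOf C := limMKerOf_add C 1
  have hC1 : ∀ j, C (j + 1) = unitK ((Lc : ℝ) ^ (j + 1)) ((Lc : ℝ) ^ ((j + 1) * (d + 1))) (KTot (d := d) (Lc ^ (j + 1 + m)) (Lc ^ (j + 1))) :=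
    fun j => rfl
  have hA1 : ∀ j, A j = unitK ((Lc : ℝ) ^ j) ((Lc : ℝ) ^ (j * (d + 1))) (KTot (d := d) (Lc ^ (j + 1 + m)) (Lc ^ j)) := by
    intro j; show unitK _ _ (KTot (d := d) (Lc ^ (j + (m + 1))) (Lc ^ j)) = _; rw [show j + (m + 1) = j + 1 + m by omega]
  have hB1 : ∀ j, B j = unitK ((Lc : ℝ) ^ j) ((Lc : ℝ) ^ (j * (d + 1))) (KTot (d := d) (Lc ^ (j + 1)) (Lc ^ j)) := fun j => rfl
  -- entrywise convergence to the constructed limits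
  have tA : ∀ x y a b, Tendsto (fun j => A j x y a b) atTop (𝓝 (limMKerOf A x y a b)) :=
    fun x y a b => tendsto_limMKerOf_apply x y a b (hconvA x y a b)
  have tB : ∀ x y a b, Tendsto (fun j => B j x y a b) atTop (𝓝 (limMKerOf B x y a b)) :=
    fun x y a b => tendsto_limMKerOf_apply x y a b (hconvB x y a b)
  have tC : ∀ x y a b, Tendsto (fun j => C (j + 1) x y a b) atTop (𝓝 (limMKerOf C x y a b)) := by
    intro x y a b
    rw [← hKC']
    refine tendsto_limMKerOf_apply (K := fun j => C (j + 1)) x y a b ?_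
    obtain ⟨L, hL⟩ := hconvC x y a b
    exact ⟨L, hL.comp (tendsto_add_atTop_nat 1)⟩
  have tT := tendsto_comp_liftW_comp Lc (B := B) (S := fun j => C (j + 1)) tB (fun z w μ ν => tC z w _ _) hBd hδB
    (fun j z w μ ν => hCb (j + 1) z w _ _) x y κ l
  rw [hKA, hKB, hKC]
  have h := (tA x y (Sum.inl κ) (Sum.inl l)).sub ((tB x y (Sum.inl κ) (Sum.inl l)).sub (tT.const_mul ((((Lc : ℝ)) * ((Lc : ℝ)))⁻¹)))
  simp only [hA1, hB1, hC1] at h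
  exact h

/-- [our proof] **THE PERFECT BOTTOM DEFECT IS THE ENTRYWISE LIMIT OF THE RESCALED FINITE-`j` BOTTOM DEFECTS — UNCONDITIONAL** (`d + 1 = 4`, `Lc ≥ 2`, `m ≥ 1`;
units `sfStep Lc j = Lc^j`, `smStep 3 Lc j = Lc^{4j}`): `tendsto_perfectDefectBottom_apply` with ALL rows supplied by `RealRateKMHolds.tendsto_KTot_KPerf_holds` (three families)
and `KSlotJMHolds.kSlotJM_holds` (at `1` and at `m`); the limit is the owner's `PerfectGaugeDefectBottom` bracket VERBATIM. -/
theorem tendsto_perfectDefectBottom_apply_holds (hLc : 2 ≤ Lc) {m : ℕ} (hm : 1 ≤ m) (x y : Fin (3 + 1) → ℤ) (κ l : Fin (3 + 1)) :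
    Tendsto (fun j =>
        unitK (sfStep Lc j) (smStep 3 Lc j) (KTot (d := 3) (Lc ^ (j + 1 + m)) (Lc ^ j)) x y (Sum.inl κ) (Sum.inl l)
          - (unitK (sfStep Lc j) (smStep 3 Lc j) (KTot (d := 3) (Lc ^ (j + 1)) (Lc ^ j)) x y (Sum.inl κ) (Sum.inl l)
            - (((Lc : ℝ)) * ((Lc : ℝ)))⁻¹
              * comp (unitK (sfStep Lc j) (smStep 3 Lc j) (KTot (d := 3) (Lc ^ (j + 1)) (Lc ^ j)))
                  (comp (liftW Lc true true
                      (unitK (sfStep Lc (j + 1)) (smStep 3 Lc (j + 1)) (KTot (d := 3) (Lc ^ (j + 1 + m)) (Lc ^ (j + 1)))))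
                    (unitK (sfStep Lc j) (smStep 3 Lc j) (KTot (d := 3) (Lc ^ (j + 1)) (Lc ^ j))))
                  x y (Sum.inl κ) (Sum.inl l)))
      atTop
      (𝓝 (KPerf (d := 3) Lc (sfStep Lc) (smStep 3 Lc) (m + 1) x y (Sum.inl κ) (Sum.inl l)
          - (KPerf (d := 3) Lc (sfStep Lc) (smStep 3 Lc) 1 x y (Sum.inl κ) (Sum.inl l)
            - (((Lc : ℝ)) * ((Lc : ℝ)))⁻¹
              * comp (KPerf (d := 3) Lc (sfStep Lc) (smStep 3 Lc) 1)
                  (comp (liftW Lc true true (KPerf (d := 3) Lc (sfStep Lc) (smStep 3 Lc) m))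
                    (KPerf (d := 3) Lc (sfStep Lc) (smStep 3 Lc) 1))
                  x y (Sum.inl κ) (Sum.inl l)))) := by
  obtain ⟨C1, δ1, _, _, hδ1, _, _, h1d, _⟩ := kSlotJM_holds (Lc := Lc) hLc (le_refl 1)
  obtain ⟨CB, δB, _, _, hδB, _, _, hBd, _⟩ := kSlotJM_holds (Lc := Lc) hLc hm
  have hsf : (sfStep Lc) = fun j => (Lc : ℝ) ^ j := rfl
  have hsm : (smStep 3 Lc) = fun j => (Lc : ℝ) ^ (j * (3 + 1)) := rfl
  rw [hsf, hsm]
  refine tendsto_perfectDefectBottom_apply (d := 3) Lc m (CB := C1) (δB := δ1) (CS := CB) hδ1 ?_ ?_ ?_ ?_ ?_ x y κ l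
  · intro x y a b
    exact ⟨_, tendsto_KTot_KPerf_holds hLc (m := m + 1) (by omega) x y a b⟩
  · intro x y a b
    exact ⟨_, tendsto_KTot_KPerf_holds hLc (m := 1) le_rfl x y a b⟩
  · intro x y a b
    exact ⟨_, tendsto_KTot_KPerf_holds hLc hm x y a b⟩
  · exact h1d
  · intro j z w a b
    exact decays_le_const (hBd j) hδB.le z w a b

/-! ## §3 Finite windows: a bilinear window that vanishes at every finite `j` vanishes at the perfect objects -/

/-- [folklore] **A FINITE BILINEAR WINDOW OF AN ENTRYWISE-CONVERGENT FAMILY THAT VANISHES EVENTUALLY VANISHES AT THE LIMIT** (generic: finite sums of limits). -/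
theorem window_eq_zero_of_eventually {ι σ : Type*} (S : Finset ι) (T : Finset ι) (Sc Tc : Finset σ)
    {E : ℕ → ι → ι → σ → σ → ℝ} {Einf : ι → ι → σ → σ → ℝ}
    (hE : ∀ x ∈ S, ∀ y ∈ T, ∀ κ ∈ Sc, ∀ l ∈ Tc, Tendsto (fun j => E j x y κ l) atTop (𝓝 (Einf x y κ l)))
    (p q : ι → σ → ℝ)
    (h0 : ∀ᶠ j in atTop, ∑ x ∈ S, ∑ κ ∈ Sc, ∑ y ∈ T, ∑ l ∈ Tc, p x κ * E j x y κ l * q y l = 0) :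
    ∑ x ∈ S, ∑ κ ∈ Sc, ∑ y ∈ T, ∑ l ∈ Tc, p x κ * Einf x y κ l * q y l = 0 := by
  have lim : Tendsto (fun j => ∑ x ∈ S, ∑ κ ∈ Sc, ∑ y ∈ T, ∑ l ∈ Tc, p x κ * E j x y κ l * q y l) atTop
      (𝓝 (∑ x ∈ S, ∑ κ ∈ Sc, ∑ y ∈ T, ∑ l ∈ Tc, p x κ * Einf x y κ l * q y l)) :=
    tendsto_finsetSum _ fun x hx => tendsto_finsetSum _ fun κ hκ => tendsto_finsetSum _ fun y hy =>
      tendsto_finsetSum _ fun l hl => ((hE x hx y hy κ hκ l hl).const_mul _).mul_const _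
  have lim0 : Tendsto (fun j => ∑ x ∈ S, ∑ κ ∈ Sc, ∑ y ∈ T, ∑ l ∈ Tc, p x κ * E j x y κ l * q y l) atTop (𝓝 0) :=
    tendsto_const_nhds.congr' (h0.mono fun j hj => hj.symm)
  exact tendsto_nhds_unique lim lim0

/-- [our proof] **SPLIT (i-b): EVERY FINITE WINDOW OF THE PERFECT BOTTOM DEFECT THAT VANISHES AT (EVENTUALLY) EVERY FINITE `j` — IN THE BARE `KTot` CURRENCY —
VANISHES** (`d + 1 = 4`, `Lc ≥ 2`, `m ≥ 1`; UNCONDITIONAL).  For all finsets `S T` of sites and all coefficient families `p q` (e.g. a row of `trK Π` and a column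
of `Π` for a finite-window kernel `Π`): if, for all large `j`,
`Σ_{x∈S} Σ_κ Σ_{y∈T} Σ_l p x κ · [KTot_{(j,1+m)} − (KTot_{(j,1)} − ((Lc^j)^5)²·KTot_{(j,1)} ∘ liftW Lc true true (KTot_{(j+1,m)}) ∘ KTot_{(j,1)})](x,y;inl κ,inl l) · q y l = 0`,
then `Σ_{x∈S} Σ_κ Σ_{y∈T} Σ_l p x κ · E♭_m(x,y;κ,l) · q y l = 0`, `E♭_m` the owner's `PerfectGaugeDefectBottom` bracket. -/
theorem perfectDefectBottom_window_eq_zero_holds (hLc : 2 ≤ Lc) {m : ℕ} (hm : 1 ≤ m) (S T : Finset (Fin (3 + 1) → ℤ))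
    (p q : (Fin (3 + 1) → ℤ) → Fin (3 + 1) → ℝ)
    (h0 : ∀ᶠ j in atTop, ∑ x ∈ S, ∑ κ : Fin (3 + 1), ∑ y ∈ T, ∑ l : Fin (3 + 1), p x κ
        * (KTot (d := 3) (Lc ^ (j + 1 + m)) (Lc ^ j) x y (Sum.inl κ) (Sum.inl l)
          - (KTot (d := 3) (Lc ^ (j + 1)) (Lc ^ j) x y (Sum.inl κ) (Sum.inl l)
            - ((((Lc ^ j : ℕ) : ℝ)) ^ (3 + 2) * (((Lc ^ j : ℕ) : ℝ)) ^ (3 + 2))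
              * comp (KTot (d := 3) (Lc ^ (j + 1)) (Lc ^ j))
                  (comp (liftW Lc true true (KTot (d := 3) (Lc ^ (j + 1 + m)) (Lc ^ (j + 1)))) (KTot (d := 3) (Lc ^ (j + 1)) (Lc ^ j)))
                  x y (Sum.inl κ) (Sum.inl l)))
        * q y l = 0) :
    ∑ x ∈ S, ∑ κ : Fin (3 + 1), ∑ y ∈ T, ∑ l : Fin (3 + 1), p x κ
        * (KPerf (d := 3) Lc (sfStep Lc) (smStep 3 Lc) (m + 1) x y (Sum.inl κ) (Sum.inl l)
          - (KPerf (d := 3) Lc (sfStep Lc) (smStep 3 Lc) 1 x y (Sum.inl κ) (Sum.inl l)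
            - (((Lc : ℝ)) * ((Lc : ℝ)))⁻¹
              * comp (KPerf (d := 3) Lc (sfStep Lc) (smStep 3 Lc) 1)
                  (comp (liftW Lc true true (KPerf (d := 3) Lc (sfStep Lc) (smStep 3 Lc) m))
                    (KPerf (d := 3) Lc (sfStep Lc) (smStep 3 Lc) 1))
                  x y (Sum.inl κ) (Sum.inl l)))
        * q y l = 0 := by
  have hL : (Lc : ℝ) ≠ 0 := by exact_mod_cast (show Lc ≠ 0 by omega)
  refine window_eq_zero_of_eventually S T univ univ
    (E := fun j x y κ l =>
        unitK (sfStep Lc j) (smStep 3 Lc j) (KTot (d := 3) (Lc ^ (j + 1 + m)) (Lc ^ j)) x y (Sum.inl κ) (Sum.inl l)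
          - (unitK (sfStep Lc j) (smStep 3 Lc j) (KTot (d := 3) (Lc ^ (j + 1)) (Lc ^ j)) x y (Sum.inl κ) (Sum.inl l)
            - (((Lc : ℝ)) * ((Lc : ℝ)))⁻¹
              * comp (unitK (sfStep Lc j) (smStep 3 Lc j) (KTot (d := 3) (Lc ^ (j + 1)) (Lc ^ j)))
                  (comp (liftW Lc true true
                      (unitK (sfStep Lc (j + 1)) (smStep 3 Lc (j + 1)) (KTot (d := 3) (Lc ^ (j + 1 + m)) (Lc ^ (j + 1)))))
                    (unitK (sfStep Lc j) (smStep 3 Lc j) (KTot (d := 3) (Lc ^ (j + 1)) (Lc ^ j))))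
                  x y (Sum.inl κ) (Sum.inl l)))
    (fun x _ y _ κ _ l _ => tendsto_perfectDefectBottom_apply_holds Lc hLc hm x y κ l) p q ?_
  -- at every finite `j` the rescaled window is `(Lc^j)²` times the bare window
  filter_upwards [h0] with j hj
  have hsf : ∀ i, sfStep Lc i = (Lc : ℝ) ^ i := fun i => rfl
  have hsm : ∀ i, smStep 3 Lc i = (Lc : ℝ) ^ (i * (3 + 1)) := fun i => rfl
  simp only [hsf, hsm, rescaledDefectBottom_ff_eq (d := 3) Lc (by omega)]
  have hfac : ∀ (x y : Fin (3 + 1) → ℤ) (κ l : Fin (3 + 1)) (e : ℝ),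
      p x κ * ((Lc : ℝ) ^ j * (Lc : ℝ) ^ j * e) * q y l = (Lc : ℝ) ^ j * (Lc : ℝ) ^ j * (p x κ * e * q y l) := by
    intro x y κ l e; ring
  simp only [hfac, ← Finset.mul_sum]
  rw [hj, mul_zero]

/-! ## §4 Junction for (i-a): the bare finite-`j` bottom defect entry IS the `Lc^j`-decimated two-level defect of an5's currency, in closed form -/

/-- [folklore] **THE BARE FINITE-`j` BOTTOM DEFECT ENTRY IS THE `Lc^j`-BLOCK-LEG AVERAGE OF an5's TWO-LEVEL DEFECT `Γ_{N′} − Γ_M − PQ_{N′,M}` AT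
`(M, N′) = (Lc^(j+1), Lc^(j+1+m))`** (every `d`, `Lc ≥ 1`): `KTot_def` + `dec_inl_inl` + `KInv_inl_inl` (all `rfl`) and this lineage's
`PerfectTelescopingBottomFinite.dec_compB_eq_comp_KTot` ∕ `compB_eq_neg_PQ` — the LHS of `TwoLevelDefectClosedForm.twoLevelDefect_closedForm` at the fine leg points. -/
theorem bareDefectBottom_ff_eq_sum_twoLevelDefect (j m : ℕ) (x' y' : Fin (d + 1) → ℤ) (κ l : Fin (d + 1)) :
    KTot (d := d) (Lc ^ (j + 1 + m)) (Lc ^ j) x' y' (Sum.inl κ) (Sum.inl l)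
        - (KTot (d := d) (Lc ^ (j + 1)) (Lc ^ j) x' y' (Sum.inl κ) (Sum.inl l)
          - ((((Lc ^ j : ℕ) : ℝ)) ^ (d + 2) * (((Lc ^ j : ℕ) : ℝ)) ^ (d + 2))
            * comp (KTot (d := d) (Lc ^ (j + 1)) (Lc ^ j))
                (comp (liftW Lc true true (KTot (d := d) (Lc ^ (j + 1 + m)) (Lc ^ (j + 1)))) (KTot (d := d) (Lc ^ (j + 1)) (Lc ^ j)))
                x' y' (Sum.inl κ) (Sum.inl l))
      = ∑ i ∈ LegIdx d (Lc ^ j), ∑ i' ∈ LegIdx d (Lc ^ j), (((Lc ^ j : ℕ) : ℝ) ^ (d + 2))⁻¹ * (((Lc ^ j : ℕ) : ℝ) ^ (d + 2))⁻¹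
          * (Gam (N := Lc ^ (j + 1 + m)) κ (legPt (Lc ^ j) (Sum.inl κ : Fib d) x' i) l (legPt (Lc ^ j) (Sum.inl l : Fib d) y' i')
            - Gam (N := Lc ^ (j + 1)) κ (legPt (Lc ^ j) (Sum.inl κ : Fib d) x' i) l (legPt (Lc ^ j) (Sum.inl l : Fib d) y' i')
            - PQ (N := Lc ^ (j + 1 + m)) (Lc ^ (j + 1)) (legPt (Lc ^ j) (Sum.inl κ : Fib d) x' i) (legPt (Lc ^ j) (Sum.inl l : Fib d) y' i') κ l) := by
  rw [← dec_compB_eq_comp_KTot,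
    show KTot (d := d) (Lc ^ (j + 1 + m)) (Lc ^ j) x' y' (Sum.inl κ) (Sum.inl l)
        = dec (Lc ^ j) (KInv (N := Lc ^ (j + 1 + m)) (d := d)) x' y' (Sum.inl κ) (Sum.inl l) from rfl,
    show KTot (d := d) (Lc ^ (j + 1)) (Lc ^ j) x' y' (Sum.inl κ) (Sum.inl l)
        = dec (Lc ^ j) (KInv (N := Lc ^ (j + 1)) (d := d)) x' y' (Sum.inl κ) (Sum.inl l) from rfl,
    dec_inl_inl, dec_inl_inl, dec_inl_inl, ← Finset.sum_sub_distrib, ← Finset.sum_sub_distrib]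
  refine Finset.sum_congr rfl fun i _ => ?_
  rw [← Finset.sum_sub_distrib, ← Finset.sum_sub_distrib]
  refine Finset.sum_congr rfl fun i' _ => ?_
  rw [KInv_inl_inl, KInv_inl_inl, compB_eq_neg_PQ]
  ring

/-- [folklore] **… IN CLOSED FORM**: the same entry with `TwoLevelDefectClosedForm.twoLevelDefect_closedForm` (`N′ = M·L`, `M = Lc^(j+1)`, `L = Lc^m`) substituted —
every term carries the block-summed force leg `blockSum_M (Mcol_{N′} …) y₀` (`= −dz θ_{y₀}`, `GaugeMultiplierBiLaplace`) on exactly one fine leg point and the exact force column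
`(codiff₁∘dz∘codiff₁)(Γ_M(·))(M•y₀)` on the other: the object leaf-06's (i-a) contracts with the finite-window projector. -/
theorem bareDefectBottom_ff_eq_sum_closedForm (j m : ℕ) (x' y' : Fin (d + 1) → ℤ) (κ l : Fin (d + 1)) :
    KTot (d := d) (Lc ^ (j + 1 + m)) (Lc ^ j) x' y' (Sum.inl κ) (Sum.inl l)
        - (KTot (d := d) (Lc ^ (j + 1)) (Lc ^ j) x' y' (Sum.inl κ) (Sum.inl l)
          - ((((Lc ^ j : ℕ) : ℝ)) ^ (d + 2) * (((Lc ^ j : ℕ) : ℝ)) ^ (d + 2))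
            * comp (KTot (d := d) (Lc ^ (j + 1)) (Lc ^ j))
                (comp (liftW Lc true true (KTot (d := d) (Lc ^ (j + 1 + m)) (Lc ^ (j + 1)))) (KTot (d := d) (Lc ^ (j + 1)) (Lc ^ j)))
                x' y' (Sum.inl κ) (Sum.inl l))
      = ∑ i ∈ LegIdx d (Lc ^ j), ∑ i' ∈ LegIdx d (Lc ^ j), (((Lc ^ j : ℕ) : ℝ) ^ (d + 2))⁻¹ * (((Lc ^ j : ℕ) : ℝ) ^ (d + 2))⁻¹
          * ∑' y₀ : (Fin (d + 1) → ℤ),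
            (codiff₁ (dz (codiff₁ (Gcol (N := Lc ^ (j + 1)) κ (legPt (Lc ^ j) (Sum.inl κ : Fib d) x' i)))) (((Lc ^ (j + 1) : ℕ) : ℤ) • y₀)
                * blockSum (Lc ^ (j + 1)) (Mcol (N := Lc ^ (j + 1 + m)) l (legPt (Lc ^ j) (Sum.inl l : Fib d) y' i')) y₀
              + blockSum (Lc ^ (j + 1)) (Mcol (N := Lc ^ (j + 1 + m)) κ (legPt (Lc ^ j) (Sum.inl κ : Fib d) x' i)) y₀
                * codiff₁ (dz (codiff₁ (Gcol (N := Lc ^ (j + 1)) l (legPt (Lc ^ j) (Sum.inl l : Fib d) y' i')))) (((Lc ^ (j + 1) : ℕ) : ℤ) • y₀)) := by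
  rw [bareDefectBottom_ff_eq_sum_twoLevelDefect]
  refine Finset.sum_congr rfl fun i _ => Finset.sum_congr rfl fun i' _ => ?_
  rw [twoLevelDefect_closedForm (N' := Lc ^ (j + 1 + m)) (M := Lc ^ (j + 1)) (L := Lc ^ m) (by rw [← pow_add])]

end Summit.QuantumFields.BalabanUV.Beta.FP.PerfectGaugeDefectBottomLimit

end
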